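import Summits.HodgeConjecture.HodgeConjecture.Cruxes.BlochSeedDiscOne.AxisPhaseTorus
import Summits.HodgeConjecture.HodgeConjecture.Cruxes.BlochSeedDiscOne.PhaseTorusLawN13
import Summits.HodgeConjecture.HodgeConjecture.Cruxes.BlochSeedDiscOne.LeggedFloor

/-!
line stmt-HodgeConjecture-18881 Cruxes/BlochSeedDiscOne/Lines/birth.lean 814a6a70c14e831a stub_rung_pad4_seedAt

# RayClassMeasure — the phase-torus law OFF THE AXIS: every (A1)-clean design has a RAY CLASS MEASURE on `(ℤ/4)⁴`
with the design's own moments (strengthen g22, companion to `AxisPhaseTorus.lean` / `AxisSPlus.lean`; imports only farm-built modules)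

HONEST LABEL.  Nothing in this file proves HC, HC_AV, HC_CM, H2, №4, item 26512 or item 18881; letters ≠ sheaves ≠ SEED.
It is a finite letter calculus about two-level letter designs (`DepthBoundA4.Design`), typed as evidence for the cell's
S⁺ programme (door of record `RuleDPlate.SPlus 14 sigmaH 0`, closed on the AXIS road by `AxisSPlus.sPlusB_axisRoom_budget`;
`AxisSPlus.sPlus_iff_offAxis` leaves exactly the designs with an OFF-AXIS support letter).

## What is typed (every height `h`, every design on the alphabet — axis or not, hub-bearing or not)

1. RAY COMPONENTS.  A letter `β = x + iy` decomposes along the four rays `i^p`: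
   `λ(ℓ,p) = max(0, ⟨β, i^p⟩)` (`p = 0,1,2,3 ↦ x⁺, y⁺, x⁻, y⁻`), with `Σ_p λ(ℓ,p) = |x| + |y| = c(ℓ)` (`sum_lam`),
   `λ(ℓ,0) − λ(ℓ,2) = x`, `λ(ℓ,1) − λ(ℓ,3) = y`; so the per-slot DFT of `λ(ℓ,·)` at the frequencies `0, 1, 3` is
   `c, β, β̄` (`slot_dict`) — EXACTLY the letter data `dval C, dval Eb, dval E` read by the decorated e-rows of
   `ShellThreePairLaw`.  (On an axis letter `λ(ℓ,·)` is `c·δ_{phase}`: the class measure of `AxisPhaseTorus` is the special case.)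
2. RAY CLASS MEASURE.  `w_τ(c) = ∏_f λ(c_f, τ_f) ≥ 0` and `ω(τ) = (Σ_N − Σ_P) m·w_τ` (`wray`, `omegaRay`).  THE DICTIONARY
   (`cell_dict`, `moment_omegaRay`): for every frequency `k` without a `2`, `ω̂(k) = (Σ_N − Σ_P) m·Φ_k`, hence
   `ω̂(k) = 0` for admissible `k ≠ 0` by (A1) clause 1 alone (`moment_omegaRay_adm`, the decorated e-row law),
   `ω̂(0) = E_h(D)` (`moment_omegaRay_zero`; `E = 4·(Σ_N − Σ_P) m·pw·pw'` by the pair law, NOT zero off the axis) and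
   `ω̂(1,1,1,1) = μ̄` (`moment_omegaRay_top`).
3. THE E-SHIFT.  `ω° = ω − E/256` has ALL admissible moments zero and the same top moment (`moment_omegaShift_adm/top`:
   the character sums `Σ_τ χ_k(τ)` vanish for `k ≠ 0`).  So the kernel theorem `PhaseTorusLawN 13` (`PhaseTorusLawN13`)
   applies to `ω°` (and to `−ω°`):  **(A1) ∧ μ ≠ 0 ∧ E ≥ 0 ⟹ ω > 0 on ≥ 14 classes;  (A1) ∧ μ ≠ 0 ∧ E ≤ 0 ⟹ ω < 0 on
   ≥ 14 classes** (`fourteen_le_posRay`, `fourteen_le_negRay`, `ray_dichotomy`) — the sign-sensitive class law off the axis,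
   with the SIGN OF `E = 4(k^N − k^P)` deciding which side (N or P) must spread.
3b. BOX LAW (E-free).  `32·ω°(box s) = −Re(e(−Σs)·μ̄)` for every phase box `s + {0,1}⁴` (`box_omegaShift`, from
   `PhaseTorusBoxLaw.boxLaw`); proper slabs carry only the uniform `E`-mass (`slab_omegaRay`); total mass `Σ_τ ω = E`
   (`sum_omegaRay`).  Hence (`μ ≠ 0`) a whole CORNER CLASS (the 64 boxes with corner sum `j`) of positive boxes and one of
   negative boxes (`exists_cornerClass_pos/neg`, torus level), so for `E ≥ 0` every box of some class contains a positive
   ray class (`posRay_meets_cornerClass`), for `E ≤ 0` a negative one (`negRay_meets_cornerClass`).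
3c. WHO MUST SPREAD (pair law `E = 4(k^N − k^P)`, `ShellThreePairLaw.pair_law_alphabet`): if at SOME slot pair no P-cell is
   off-axis at both slots then `E ≥ 0` and the N side has `≥ 14` positive ray classes (`fourteen_le_posRay_of_P_pairAxis`);
   if at some slot pair no N-cell is doubly off-axis then `E ≤ 0` and the P side has `≥ 14` negative ray classes
   (`fourteen_le_negRay_of_N_pairAxis`) — e.g. in a «compass» N-support (≤ 1 off-axis letter per N-cell) it is P that spreads.
4. POSITIVITY TRANSFER AND THE PRICE OF A CLASS.  `ω(τ) > 0 ⟹` some N-cell `c` TOUCHES `τ`: every letter `c_f` lies in the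
   OPEN HALF-PLANE of the ray `τ_f` (`exists_suppN_of_posRay`, `wray_pos_iff`).  A letter touches at most the two rays
   bounding its open quadrant, an axis letter exactly its own ray (`letter_corner`, `letter_corner_axis`); so a cell touches
   at most `16` classes (`touch_card_le`), an axis cell at most one (`touch_card_le_one_of_axisCell`), and
   `14 ≤ Σ_{N-cells} #touch(c)` when `E ≥ 0`, `14 ≤ Σ_{P-cells} #touch(c)` when `E ≤ 0` (`fourteen_le_sum_touch_N/P`).
   THIS IS WHERE OFF-AXIS DESIGNS ARE CHEAPER: one cell with four open-quadrant letters serves up to 16 classes, an axis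
   cell serves one — the angular half of (A1) no longer forces 14 CELLS, only 14 CLASSES.
4b. CORNER SPREAD LAW.  The touch set of a cell lies in ONE box (`touch_subset_pbox`); a box meets at most `21` boxes of a
   corner class (`card_cornerClass_near_le`, bounded fact `card_near_le` by `decide`), a point at most `6`; so
   `64 ≤ Σ_{N-cells} #(class-j boxes met)` with terms `≤ 21` (`≤ 6` for axis cells) when `E ≥ 0` (`sixtyfour_le_sum_boxes_N`,
   `card_boxes_met_le`, `card_boxes_met_le_six_of_axisCell`), mirrored on P when `E ≤ 0`: the charged side has `≥ 4` cells
   (`four_le_card_suppN/P`) whose corner boxes `{0,±1}`-cover a whole residue class — angular spread that the bare count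
   `≥ 14 classes` does not see (one fat cell alone has 16 classes but covers ≤ 21 < 64 boxes).
5. THE SUPPLIER GEOMETRY OF `λ` (for the RULE-D mass engine of `AxisSPlus` §2): along a null step that keeps the closed
   quadrant every ray component weakly GROWS downward (`lam_mono_of_nullStep`, from `QuadrantSlide.quadrant_slide`), so
   `w_τ` grows along quadrant-keeping supplier pairs (`wray_mono_of_supplies`); along a CROSSING (Pythagorean) step a
   component may drop, but only a component of value `≤ 2` (`h ≤ 14`, `lam_mono_or_le_two`, from
   `QuadrantSlide.cross_coord_le_two_x/y`).  The threshold regions `{w_τ ≥ s}` are therefore supplier-closed exactly up to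
   the Pythagorean steps out of letters with a coordinate `±1, ±2` — the located obstruction to running `AxisSPlus.nmass_ge_59`
   verbatim off the axis (the other one being item 4: touch sets of fat cells overlap, so class regions are not disjoint).
-/

set_option linter.dupNamespace false
set_option autoImplicit false

namespace Summit.HodgeConjecture.HodgeConjecture.Cruxes.BlochSeedDiscOne.RayClassMeasure

open Summit.HodgeConjecture.HodgeConjecture.Cruxes.BlochSeedDiscOne.DepthBoundA4
open Summit.HodgeConjecture.HodgeConjecture.Cruxes.BlochSeedDiscOne.DeepLayerLaws (colevel_eq_of_onAlphabet colevel_nonneg)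
open Summit.HodgeConjecture.HodgeConjecture.Cruxes.BlochSeedDiscOne.LeggedFloor (NullStep Supplies)
open Summit.HodgeConjecture.HodgeConjecture.Cruxes.BlochSeedDiscOne.RingTwoMassLaw.CI (A1e a1e_of_a1 wsum wsum_cons wsum_nil T_eq_wsum)
open Summit.HodgeConjecture.HodgeConjecture.Cruxes.BlochSeedDiscOne.RingTwoMassLaw.ClassLaw
open Summit.HodgeConjecture.HodgeConjecture.Cruxes.BlochSeedDiscOne.ShellThreePairLaw
open Summit.HodgeConjecture.HodgeConjecture.Cruxes.BlochSeedDiscOne.PhaseTorus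
  (PT chi moment KAdm PhaseTorusLawN e e_zero e_one e_two e_three chi_eq_prod_e zmod4_cases sum_univ_zmod4
    phaseTorusLawN_thirteen pbox mem_pbox boxSum boxLaw slab mem_slab slabLaw cornerClass cornerClass_card
    sum_of_mem_cornerClass exists_mem_of_boxSum_pos e_neg_one card_corners_containing_le)
open Summit.HodgeConjecture.HodgeConjecture.Cruxes.BlochSeedDiscOne.AxisPhaseTorus
  (pat Phi Phi_zero_eq_dep Phi_one_eq_cellCoef moment_neg_fun HubFree AxisCell onAlphabet_of_memN onAlphabet_of_memP
    pw_eq_zero_of_pairAxis)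

/-! ## §1 Ray components of a letter -/

/-- the RAY COMPONENT of a letter along the ray `i^p`: `λ(ℓ,p) = max(0, ⟨β, i^p⟩)` (`x⁺, y⁺, x⁻, y⁻` for `p = 0,1,2,3`). -/
def lam (ℓ : Letter) (p : ZMod 4) : ℤ :=
  if p = 0 then max 0 ℓ.x else if p = 1 then max 0 ℓ.y else if p = 2 then max 0 (-ℓ.x) else max 0 (-ℓ.y)

theorem lam_zero (ℓ : Letter) : lam ℓ 0 = max 0 ℓ.x := by
  unfold lam; rw [if_pos rfl]

theorem lam_one (ℓ : Letter) : lam ℓ 1 = max 0 ℓ.y := by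
  unfold lam; rw [if_neg (by decide), if_pos rfl]

theorem lam_two (ℓ : Letter) : lam ℓ 2 = max 0 (-ℓ.x) := by
  unfold lam; rw [if_neg (by decide), if_neg (by decide), if_pos rfl]

theorem lam_three (ℓ : Letter) : lam ℓ 3 = max 0 (-ℓ.y) := by
  unfold lam; rw [if_neg (by decide), if_neg (by decide), if_neg (by decide)]

theorem lam_nonneg (ℓ : Letter) (p : ZMod 4) : 0 ≤ lam ℓ p := by
  unfold lam; split_ifs <;> exact le_max_left _ _

theorem lam_zero_sub_two (ℓ : Letter) : lam ℓ 0 - lam ℓ 2 = ℓ.x := by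
  rw [lam_zero, lam_two]
  rcases le_total 0 ℓ.x with h | h
  · rw [max_eq_right h, max_eq_left (neg_nonpos.mpr h)]; ring
  · rw [max_eq_left h, max_eq_right (neg_nonneg.mpr h)]; ring

theorem lam_one_sub_three (ℓ : Letter) : lam ℓ 1 - lam ℓ 3 = ℓ.y := by
  rw [lam_one, lam_three]
  rcases le_total 0 ℓ.y with h | h
  · rw [max_eq_right h, max_eq_left (neg_nonpos.mpr h)]; ring
  · rw [max_eq_left h, max_eq_right (neg_nonneg.mpr h)]; ring

theorem lam_zero_add_two (ℓ : Letter) : lam ℓ 0 + lam ℓ 2 = |ℓ.x| := by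
  rw [lam_zero, lam_two]
  rcases le_total 0 ℓ.x with h | h
  · rw [max_eq_right h, max_eq_left (neg_nonpos.mpr h), abs_of_nonneg h]; ring
  · rw [max_eq_left h, max_eq_right (neg_nonneg.mpr h), abs_of_nonpos h]; ring

theorem lam_one_add_three (ℓ : Letter) : lam ℓ 1 + lam ℓ 3 = |ℓ.y| := by
  rw [lam_one, lam_three]
  rcases le_total 0 ℓ.y with h | h
  · rw [max_eq_right h, max_eq_left (neg_nonpos.mpr h), abs_of_nonneg h]; ring
  · rw [max_eq_left h, max_eq_right (neg_nonneg.mpr h), abs_of_nonpos h]; ring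

/-- `Σ_p λ(ℓ,p) = |x| + |y|`, the co-level. -/
theorem sum_lam (ℓ : Letter) : ∑ p : ZMod 4, lam ℓ p = ℓ.colevel := by
  rw [sum_univ_zmod4]
  unfold Letter.colevel
  rw [← lam_zero_add_two, ← lam_one_add_three]; ring

theorem lam_zero_eq_zero (ℓ : Letter) (h : ℓ.x ≤ 0) : lam ℓ 0 = 0 := by rw [lam_zero, max_eq_left h]
theorem lam_one_eq_zero (ℓ : Letter) (h : ℓ.y ≤ 0) : lam ℓ 1 = 0 := by rw [lam_one, max_eq_left h]
theorem lam_two_eq_zero (ℓ : Letter) (h : 0 ≤ ℓ.x) : lam ℓ 2 = 0 := by rw [lam_two, max_eq_left (neg_nonpos.mpr h)]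
theorem lam_three_eq_zero (ℓ : Letter) (h : 0 ≤ ℓ.y) : lam ℓ 3 = 0 := by rw [lam_three, max_eq_left (neg_nonpos.mpr h)]

/-- the slot DFT at frequency `0`: `Σ_p λ(ℓ,p) = c`. -/
theorem sum_lam_e_zero (ℓ : Letter) : ∑ p : ZMod 4, (lam ℓ p : ℂ) * e (0 * p) = ((ℓ.colevel : ℤ) : ℂ) := by
  simp only [zero_mul, e_zero, mul_one]
  rw [← sum_lam ℓ, Int.cast_sum]

/-- the slot DFT at frequency `1`: `Σ_p λ(ℓ,p)·i^p = β`. -/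
theorem sum_lam_e_one (ℓ : Letter) : ∑ p : ZMod 4, (lam ℓ p : ℂ) * e (1 * p) = ((ℓ.beta : GaussianInt) : ℂ) := by
  simp only [one_mul]
  rw [sum_univ_zmod4, e_zero, e_one, e_two, e_three]
  have hx : ((lam ℓ 0 : ℤ) : ℂ) - ((lam ℓ 2 : ℤ) : ℂ) = ((ℓ.x : ℤ) : ℂ) := by rw [← Int.cast_sub, lam_zero_sub_two]
  have hy : ((lam ℓ 1 : ℤ) : ℂ) - ((lam ℓ 3 : ℤ) : ℂ) = ((ℓ.y : ℤ) : ℂ) := by rw [← Int.cast_sub, lam_one_sub_three]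
  unfold Letter.beta
  rw [GaussianInt.toComplex_def', ← hx, ← hy]; ring

/-- the slot DFT at frequency `3`: `Σ_p λ(ℓ,p)·i^{3p} = β̄`. -/
theorem sum_lam_e_three (ℓ : Letter) : ∑ p : ZMod 4, (lam ℓ p : ℂ) * e (3 * p) = ((star ℓ.beta : GaussianInt) : ℂ) := by
  rw [sum_univ_zmod4, show ((3 : ZMod 4) * 0) = 0 from by decide, show ((3 : ZMod 4) * 1) = 3 from by decide,
    show ((3 : ZMod 4) * 2) = 2 from by decide, show ((3 : ZMod 4) * 3) = 1 from by decide, e_zero, e_one, e_two, e_three]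
  have hx : ((lam ℓ 0 : ℤ) : ℂ) - ((lam ℓ 2 : ℤ) : ℂ) = ((ℓ.x : ℤ) : ℂ) := by rw [← Int.cast_sub, lam_zero_sub_two]
  have hy : ((lam ℓ 1 : ℤ) : ℂ) - ((lam ℓ 3 : ℤ) : ℂ) = ((ℓ.y : ℤ) : ℂ) := by rw [← Int.cast_sub, lam_one_sub_three]
  unfold Letter.beta
  rw [Zsqrtd.star_mk, GaussianInt.toComplex_def', Int.cast_neg, ← hx, ← hy]; ring

/-- THE SLOT DICTIONARY: for `k_f ≠ 2`, `Σ_p λ(ℓ,p) i^{k_f p} = dval (pat k f) ℓ` (`c`, `β`, `β̄` for `k_f = 0, 1, 3`), for every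
letter of the alphabet — axis or not, charged or not. -/
theorem slot_dict {h : ℤ} {ℓ : Letter} (hℓ : ℓ.OnAlphabet h) (k : PT) (f : Fin 4) (hk : k f ≠ 2) :
    ∑ p : ZMod 4, (lam ℓ p : ℂ) * e (k f * p) = ((dval h (pat k f) ℓ : GaussianInt) : ℂ) := by
  unfold pat
  rcases zmod4_cases (k f) with h0 | h1 | h2 | h3
  · rw [if_pos h0, h0, sum_lam_e_zero]
    show ((ℓ.colevel : ℤ) : ℂ) = ((((h - ℓ.a : ℤ)) : GaussianInt) : ℂ)
    rw [map_intCast, ← colevel_eq_of_onAlphabet hℓ]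
  · rw [if_neg (by rw [h1]; decide), if_pos h1, h1, sum_lam_e_one]; rfl
  · exact absurd h2 hk
  · rw [if_neg (by rw [h3]; decide), if_neg (by rw [h3]; decide), h3, sum_lam_e_three]; rfl

/-! ## §2 The ray class measure of a design and its moment dictionary -/

/-- the ray-class weight of a cell at the class `τ ∈ (ℤ/4)⁴`: `w_τ(c) = ∏_f λ(c_f, τ_f)`. -/
def wray (τ : PT) (c : Cell) : ℤ := ∏ f : Fin 4, lam (c f) (τ f)

theorem wray_nonneg (τ : PT) (c : Cell) : 0 ≤ wray τ c := Finset.prod_nonneg fun _ _ => lam_nonneg _ _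

/-- `Σ_τ w_τ(c) = ∏_f c_f` = the depth product `dep` on the alphabet. -/
theorem sum_wray {h : ℤ} {c : Cell} (hc : ∀ f, (c f).OnAlphabet h) : ∑ τ : PT, wray τ c = dep h c := by
  unfold wray dep
  rw [show (∏ f : Fin 4, (h - (c f).a)) = ∏ f : Fin 4, ∑ p : ZMod 4, lam (c f) p from
    Finset.prod_congr rfl fun f _ => by rw [sum_lam, colevel_eq_of_onAlphabet (hc f)]]
  rw [Finset.prod_univ_sum, Fintype.piFinset_univ]

/-- THE CELL DICTIONARY: `Σ_τ w_τ(c) χ_k(τ) = Φ_k(c)` for every frequency `k` without a `2` and every cell on the alphabet. -/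
theorem cell_dict {h : ℤ} {c : Cell} (hc : ∀ f, (c f).OnAlphabet h) (k : PT) (hk : ∀ f, k f ≠ 2) :
    ∑ τ : PT, (wray τ c : ℂ) * chi k τ = ((Phi h k c : GaussianInt) : ℂ) := by
  have h1 : ∀ τ : PT, (wray τ c : ℂ) * chi k τ = ∏ f : Fin 4, ((lam (c f) (τ f) : ℂ) * e (k f * τ f)) := fun τ => by
    unfold wray; rw [chi_eq_prod_e, Int.cast_prod, ← Finset.prod_mul_distrib]
  rw [Finset.sum_congr rfl fun τ _ => h1 τ]
  unfold Phi
  rw [map_prod, show (∏ f : Fin 4, ((dval h (pat k f) (c f) : GaussianInt) : ℂ))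
      = ∏ f : Fin 4, ∑ p : ZMod 4, (lam (c f) p : ℂ) * e (k f * p) from
      Finset.prod_congr rfl fun f _ => (slot_dict (hc f) k f (hk f)).symm]
  rw [Finset.prod_univ_sum, Fintype.piFinset_univ]

theorem sum_linZ_wray_chi {h : ℤ} (L : List (Cell × ℕ)) (hL : ∀ cm ∈ L, 0 < cm.2 → ∀ f, (cm.1 f).OnAlphabet h)
    (k : PT) (hk : ∀ f, k f ≠ 2) :
    ∑ τ : PT, ((linZ L (wray τ) : ℤ) : ℂ) * chi k τ = ((wsum L (Phi h k) : GaussianInt) : ℂ) := by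
  induction L with
  | nil => simp [linZ_nil, wsum_nil]
  | cons a l ih =>
    have hl : ∀ cm ∈ l, 0 < cm.2 → ∀ f, (cm.1 f).OnAlphabet h := fun cm hcm => hL cm (List.mem_cons_of_mem _ hcm)
    simp only [linZ_cons, Int.cast_add, Int.cast_mul, Int.cast_natCast, add_mul, Finset.sum_add_distrib]
    rw [ih hl, wsum_cons, map_add, map_mul, map_natCast]
    congr 1
    rcases Nat.eq_zero_or_pos a.2 with h0 | hpos
    · rw [h0]; simp
    · have ha := hL a (List.mem_cons_self) hpos
      rw [← cell_dict ha k hk, Finset.mul_sum]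
      exact Finset.sum_congr rfl fun τ _ => by ring

/-- the RAY CLASS MEASURE `ω(τ) = (Σ_N − Σ_P) m·w_τ`. -/
def omegaRay (D : Design) (τ : PT) : ℤ := linZ D.N (wray τ) - linZ D.P (wray τ)

/-- … as a real function on the phase torus. -/
noncomputable def omegaRayR (D : Design) : PT → ℝ := fun τ => (omegaRay D τ : ℝ)

/-- **THE MOMENT DICTIONARY** (every design on the alphabet): for every frequency `k` without a `2`,
`ω̂(k) = (Σ_N − Σ_P) m·Φ_k` — a decorated e-row. -/
theorem moment_omegaRay {h : ℤ} {D : Design} (hD : D.OnAlphabet h) (k : PT) (hk : ∀ f, k f ≠ 2) :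
    moment (omegaRayR D) k = ((wsum D.N (Phi h k) - wsum D.P (Phi h k) : GaussianInt) : ℂ) := by
  have hN := sum_linZ_wray_chi D.N
    (fun cm hcm hpos => onAlphabet_of_memN hD ((mem_suppN_iff D cm.1).mpr ⟨cm.2, hcm, hpos⟩)) k hk
  have hP := sum_linZ_wray_chi D.P
    (fun cm hcm hpos => onAlphabet_of_memP hD ((mem_suppP_iff D cm.1).mpr ⟨cm.2, hcm, hpos⟩)) k hk
  unfold moment omegaRayR omegaRay
  simp only [Int.cast_sub, Complex.ofReal_sub, Complex.ofReal_intCast, sub_mul, Finset.sum_sub_distrib]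
  rw [hN, hP, map_sub]

/-- `ω̂(0) = E_h(D)` (the pair-law quantity `4(k^N − k^P)`; zero in the axis room, not in general). -/
theorem moment_omegaRay_zero {h : ℤ} {D : Design} (hD : D.OnAlphabet h) : moment (omegaRayR D) 0 = ((E h D : ℤ) : ℂ) := by
  rw [moment_omegaRay hD 0 (fun f => by show (0 : ZMod 4) ≠ 2; decide)]
  have : wsum D.N (Phi h 0) - wsum D.P (Phi h 0) = (((linZ D.N (dep h) - linZ D.P (dep h) : ℤ)) : GaussianInt) := by
    rw [funext (Phi_zero_eq_dep h), wsum_cast, wsum_cast]; push_cast; rfl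
  rw [this, map_intCast]; rfl

/-- `ω̂(1,1,1,1) = μ̄`. -/
theorem moment_omegaRay_top {h : ℤ} {D : Design} (hD : D.OnAlphabet h) :
    moment (omegaRayR D) (fun _ => 1) = ((star D.mu : GaussianInt) : ℂ) := by
  rw [moment_omegaRay hD (fun _ => 1) (fun _ => by decide), funext (Phi_one_eq_cellCoef h), ← T_eq_wsum, T_EEEE]

/-- the admissible NONZERO moments vanish, by (A1) clause 1 alone (decorated e-row law; no axis hypothesis, no `E = 0`). -/
theorem moment_omegaRay_adm {h : ℤ} {D : Design} (hD : D.OnAlphabet h) (h1 : D.A1) (k : PT) (hK : KAdm k) (hk0 : k ≠ 0) :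
    moment (omegaRayR D) k = 0 := by
  obtain ⟨hk2, hk1, hk3⟩ := hK
  rw [moment_omegaRay hD k hk2]
  have hmix : ∃ f, pat k f = DS.E ∨ pat k f = DS.Eb := by
    obtain ⟨f, hf⟩ := Function.ne_iff.mp hk0
    refine ⟨f, ?_⟩
    unfold pat
    rcases zmod4_cases (k f) with h0 | h1' | h2 | h3
    · exact absurd h0 hf
    · right; rw [if_neg (by rw [h1']; decide), if_pos h1']
    · exact absurd h2 (hk2 f)
    · left; rw [if_neg (by rw [h3]; decide), if_neg (by rw [h3]; decide)]
  have hE : ∃ f, pat k f ≠ DS.E := by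
    obtain ⟨f, hf⟩ := Function.ne_iff.mp hk3
    refine ⟨f, ?_⟩
    unfold pat
    rcases zmod4_cases (k f) with h0 | h1' | h2 | h3
    · rw [if_pos h0]; decide
    · rw [if_neg (by rw [h1']; decide), if_pos h1']; decide
    · exact absurd h2 (hk2 f)
    · exact absurd h3 hf
  have hEb : ∃ f, pat k f ≠ DS.Eb := by
    obtain ⟨f, hf⟩ := Function.ne_iff.mp hk1
    refine ⟨f, ?_⟩
    unfold pat
    rcases zmod4_cases (k f) with h0 | h1' | h2 | h3
    · rw [if_pos h0]; decide
    · exact absurd h1' hf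
    · exact absurd h2 (hk2 f)
    · rw [if_neg (by rw [h3]; decide), if_neg (by rw [h3]; decide)]; decide
  have row := decorated_row_law h D (a1e_of_a1 D h1) (pat k) hmix hE hEb
  unfold Phi
  rw [row, sub_self, map_zero]

/-! ## §3 The E-shift and the phase-torus step -/

theorem sum_e_mul (j : ZMod 4) (hj : j ≠ 0) : ∑ p : ZMod 4, e (j * p) = 0 := by
  rw [sum_univ_zmod4]
  rcases zmod4_cases j with h0 | h1 | h2 | h3
  · exact absurd h0 hj
  · rw [h1, show ((1 : ZMod 4) * 0) = 0 from by decide, show ((1 : ZMod 4) * 1) = 1 from by decide,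
      show ((1 : ZMod 4) * 2) = 2 from by decide, show ((1 : ZMod 4) * 3) = 3 from by decide, e_zero, e_one, e_two, e_three]
    ring
  · rw [h2, show ((2 : ZMod 4) * 0) = 0 from by decide, show ((2 : ZMod 4) * 1) = 2 from by decide,
      show ((2 : ZMod 4) * 2) = 0 from by decide, show ((2 : ZMod 4) * 3) = 2 from by decide, e_zero, e_two]
    ring
  · rw [h3, show ((3 : ZMod 4) * 0) = 0 from by decide, show ((3 : ZMod 4) * 1) = 3 from by decide,
      show ((3 : ZMod 4) * 2) = 2 from by decide, show ((3 : ZMod 4) * 3) = 1 from by decide, e_zero, e_one, e_two, e_three]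
    ring

/-- the character sums vanish off `k = 0`: `Σ_τ χ_k(τ) = 0`. -/
theorem sum_chi (k : PT) (hk : k ≠ 0) : ∑ τ : PT, chi k τ = 0 := by
  obtain ⟨f, hf⟩ := Function.ne_iff.mp hk
  have hx : ∑ τ : PT, chi k τ = ∏ g : Fin 4, ∑ p : ZMod 4, e (k g * p) := by
    rw [Finset.sum_congr rfl fun τ _ => chi_eq_prod_e k τ, Finset.prod_univ_sum, Fintype.piFinset_univ]
  rw [hx]
  exact Finset.prod_eq_zero (Finset.mem_univ f) (sum_e_mul (k f) hf)

theorem chi_zero_left (τ : PT) : chi 0 τ = 1 := by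
  rw [chi_eq_prod_e]
  exact Finset.prod_eq_one fun g _ => by rw [show (0 : PT) g * τ g = 0 from by simp, e_zero]

/-- … and `Σ_τ χ_0(τ) = 256`. -/
theorem sum_chi_zero : ∑ τ : PT, chi 0 τ = 256 := by
  rw [Finset.sum_congr rfl fun τ _ => chi_zero_left τ, Finset.sum_const, Finset.card_univ, nsmul_eq_mul, mul_one]
  norm_num [Fintype.card_pi, ZMod.card]

/-- total mass: `Σ_τ ω(τ) = E_h(D)` (every design on the alphabet). -/
theorem sum_omegaRay {h : ℤ} {D : Design} (hD : D.OnAlphabet h) : ∑ τ : PT, omegaRay D τ = E h D := by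
  have h0 := moment_omegaRay_zero hD
  unfold moment omegaRayR at h0
  simp only [chi_zero_left, mul_one] at h0
  exact_mod_cast h0

/-- the E-SHIFTED ray class measure `ω° = ω − E/256`. -/
noncomputable def omegaShift (h : ℤ) (D : Design) : PT → ℝ := fun τ => omegaRayR D τ - (E h D : ℝ) / 256

theorem moment_omegaShift (h : ℤ) (D : Design) (k : PT) :
    moment (omegaShift h D) k = moment (omegaRayR D) k - (((E h D : ℝ) / 256 : ℝ) : ℂ) * ∑ τ : PT, chi k τ := by
  unfold moment omegaShift
  simp only [Complex.ofReal_sub, sub_mul, Finset.sum_sub_distrib, Finset.mul_sum]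

/-- ALL admissible moments of `ω°` vanish (`k = 0` included). -/
theorem moment_omegaShift_adm {h : ℤ} {D : Design} (hD : D.OnAlphabet h) (h1 : D.A1) (k : PT) (hK : KAdm k) :
    moment (omegaShift h D) k = 0 := by
  rw [moment_omegaShift]
  by_cases hk0 : k = 0
  · subst hk0
    rw [moment_omegaRay_zero hD, sum_chi_zero]
    push_cast; ring
  · rw [moment_omegaRay_adm hD h1 k hK hk0, sum_chi k hk0, mul_zero, sub_zero]

/-- the top moment of `ω°` is still `μ̄`. -/
theorem moment_omegaShift_top {h : ℤ} {D : Design} (hD : D.OnAlphabet h) :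
    moment (omegaShift h D) (fun _ => 1) = ((star D.mu : GaussianInt) : ℂ) := by
  rw [moment_omegaShift, moment_omegaRay_top hD,
    sum_chi _ (fun heq => absurd (congrFun heq 0) (by decide)), mul_zero, sub_zero]

/-- **THE RAY-CLASS PHASE-TORUS STEP, `E ≥ 0`** (every height, every design on the alphabet): an (A1)-clean design with
`E ≥ 0` whose ray class measure is positive on at most `13` classes has `μ = 0`. -/
theorem mu_eq_zero_of_few_posRay {h : ℤ} {D : Design} (hD : D.OnAlphabet h) (h1 : D.A1) (hE : 0 ≤ E h D)
    (A : Finset PT) (hA : A.card ≤ 13) (hneg : ∀ τ, τ ∉ A → omegaRay D τ ≤ 0) : D.mu = 0 := by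
  have htop := phaseTorusLawN_thirteen (omegaShift h D) A hA
    (fun τ hτ => by
      unfold omegaShift omegaRayR
      have h1' : (omegaRay D τ : ℝ) ≤ 0 := by exact_mod_cast hneg τ hτ
      have h2' : (0 : ℝ) ≤ (E h D : ℝ) := by exact_mod_cast hE
      linarith)
    (fun k hK => moment_omegaShift_adm hD h1 k hK)
  rw [moment_omegaShift_top hD] at htop
  have hs : star D.mu = 0 := GaussianInt.toComplex_injective (by rw [htop, map_zero])
  simpa using congrArg star hs

/-- **THE RAY-CLASS PHASE-TORUS STEP, `E ≤ 0`**: at most `13` NEGATIVE classes and `E ≤ 0` force `μ = 0` (the law for `−ω°`). -/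
theorem mu_eq_zero_of_few_negRay {h : ℤ} {D : Design} (hD : D.OnAlphabet h) (h1 : D.A1) (hE : E h D ≤ 0)
    (A : Finset PT) (hA : A.card ≤ 13) (hpos : ∀ τ, τ ∉ A → 0 ≤ omegaRay D τ) : D.mu = 0 := by
  have htop := phaseTorusLawN_thirteen (fun τ => -omegaShift h D τ) A hA
    (fun τ hτ => by
      unfold omegaShift omegaRayR
      have h1' : (0 : ℝ) ≤ (omegaRay D τ : ℝ) := by exact_mod_cast hpos τ hτ
      have h2' : (E h D : ℝ) ≤ 0 := by exact_mod_cast hE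
      linarith)
    (fun k hK => by rw [moment_neg_fun, moment_omegaShift_adm hD h1 k hK, neg_zero])
  rw [moment_neg_fun, moment_omegaShift_top hD, neg_eq_zero] at htop
  have hs : star D.mu = 0 := GaussianInt.toComplex_injective (by rw [htop, map_zero])
  simpa using congrArg star hs

/-- the positive and the negative ray classes. -/
def posRay (D : Design) : Finset PT := Finset.univ.filter fun τ => 0 < omegaRay D τ
/-- the negative ray classes. -/
def negRay (D : Design) : Finset PT := Finset.univ.filter fun τ => omegaRay D τ < 0

theorem mem_posRay {D : Design} {τ : PT} : τ ∈ posRay D ↔ 0 < omegaRay D τ := by simp [posRay]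
theorem mem_negRay {D : Design} {τ : PT} : τ ∈ negRay D ↔ omegaRay D τ < 0 := by simp [negRay]

/-- **≥ 14 POSITIVE RAY CLASSES when `E ≥ 0`.** -/
theorem fourteen_le_posRay {h : ℤ} {D : Design} (hD : D.OnAlphabet h) (h1 : D.A1) (hE : 0 ≤ E h D) (hμ : D.mu ≠ 0) :
    14 ≤ (posRay D).card := by
  by_contra hlt
  exact hμ (mu_eq_zero_of_few_posRay hD h1 hE (posRay D) (by omega)
    fun τ hτ => not_lt.mp fun hlt' => hτ (mem_posRay.mpr hlt'))

/-- **≥ 14 NEGATIVE RAY CLASSES when `E ≤ 0`.** -/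
theorem fourteen_le_negRay {h : ℤ} {D : Design} (hD : D.OnAlphabet h) (h1 : D.A1) (hE : E h D ≤ 0) (hμ : D.mu ≠ 0) :
    14 ≤ (negRay D).card := by
  by_contra hlt
  exact hμ (mu_eq_zero_of_few_negRay hD h1 hE (negRay D) (by omega)
    fun τ hτ => not_lt.mp fun hlt' => hτ (mem_negRay.mpr hlt'))

/-- **THE RAY DICHOTOMY** (sign-sensitive class law off the axis): every (A1)-clean design with `μ ≠ 0` has `≥ 14` positive ray
classes or `≥ 14` negative ones — the sign of `E = 4(k^N − k^P)` decides which. -/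
theorem ray_dichotomy {h : ℤ} {D : Design} (hD : D.OnAlphabet h) (h1 : D.A1) (hμ : D.mu ≠ 0) :
    14 ≤ (posRay D).card ∨ 14 ≤ (negRay D).card := by
  rcases le_total 0 (E h D) with hE | hE
  · exact Or.inl (fourteen_le_posRay hD h1 hE hμ)
  · exact Or.inr (fourteen_le_negRay hD h1 hE hμ)

/-! ## §3b Box and slab masses: the cube law of the ray class measure is E-free -/

/-- proper SLABS (some coordinate free) carry only the uniform `E`-mass: `ω(slab) = |slab| · E / 256`. -/
theorem slab_omegaRay {h : ℤ} {D : Design} (hD : D.OnAlphabet h) (h1 : D.A1) (S : Finset (Fin 4))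
    (hS : S ≠ Finset.univ) (s : PT) :
    ∑ τ ∈ slab S s, (omegaRay D τ : ℝ) = (slab S s).card * ((E h D : ℝ) / 256) := by
  have := slabLaw (omegaShift h D) (fun k hK => moment_omegaShift_adm hD h1 k hK) S hS s
  unfold omegaShift omegaRayR at this
  rw [Finset.sum_sub_distrib, Finset.sum_const, nsmul_eq_mul] at this
  linarith

/-- **THE BOX LAW of the ray class measure** (every design on the alphabet, (A1) clause 1): for every phase box
`s + {0,1}⁴`, `32 · ω°(box s) = −Re(e(−Σ s) · μ̄)` — the `E`-shift makes the box masses `E`-free (dual g16's cube law,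
now for off-axis designs and the ray measure). -/
theorem box_omegaShift {h : ℤ} {D : Design} (hD : D.OnAlphabet h) (h1 : D.A1) (s : PT) :
    32 * boxSum (omegaShift h D) s = -(e (-∑ f, s f) * ((star D.mu : GaussianInt) : ℂ)).re := by
  rw [boxLaw (omegaShift h D) (fun k hK => moment_omegaShift_adm hD h1 k hK) s, moment_omegaShift_top hD]

theorem boxSum_neg (ω : PT → ℝ) (s : PT) : boxSum (fun τ => -ω τ) s = -boxSum ω s := by
  unfold boxSum; rw [Finset.sum_neg_distrib]

/-- torus level: a clean measure with `μ ≠ 0` has a whole corner class (64 boxes, corner sum `j`) of POSITIVE boxes … -/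
theorem exists_cornerClass_pos (ω : PT → ℝ) (hK : ∀ k, KAdm k → moment ω k = 0) (hμ : moment ω (fun _ => 1) ≠ 0) :
    ∃ j : ZMod 4, ∀ s ∈ cornerClass j, 0 < boxSum ω s := by
  have hcls : ∀ (j : ZMod 4) (s : PT), s ∈ cornerClass j →
      32 * boxSum ω s = -(e (-j) * moment ω (fun _ => 1)).re := by
    intro j s hs
    rw [boxLaw ω hK s, sum_of_mem_cornerClass hs]
  have hre_or : (moment ω (fun _ => 1)).re ≠ 0 ∨ (moment ω (fun _ => 1)).im ≠ 0 := by
    by_contra hc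
    push Not at hc
    exact hμ (Complex.ext (by simpa using hc.1) (by simpa using hc.2))
  rcases hre_or with hre | him
  · rcases lt_or_gt_of_ne hre with hneg | hpos
    · refine ⟨0, fun s hs => ?_⟩
      have := hcls 0 s hs
      rw [neg_zero, e_zero, one_mul] at this
      linarith
    · refine ⟨2, fun s hs => ?_⟩
      have := hcls 2 s hs
      rw [show (-2 : ZMod 4) = 2 from by decide, e_two] at this
      simp at this
      linarith
  · rcases lt_or_gt_of_ne him with hneg | hpos
    · refine ⟨1, fun s hs => ?_⟩
      have := hcls 1 s hs
      rw [e_neg_one] at this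
      simp at this
      linarith
    · refine ⟨3, fun s hs => ?_⟩
      have := hcls 3 s hs
      rw [show (-3 : ZMod 4) = 1 from by decide, e_one] at this
      simp at this
      linarith

/-- … and a whole corner class of NEGATIVE boxes. -/
theorem exists_cornerClass_neg (ω : PT → ℝ) (hK : ∀ k, KAdm k → moment ω k = 0) (hμ : moment ω (fun _ => 1) ≠ 0) :
    ∃ j : ZMod 4, ∀ s ∈ cornerClass j, boxSum ω s < 0 := by
  obtain ⟨j, hj⟩ := exists_cornerClass_pos (fun τ => -ω τ)
    (fun k hK' => by rw [moment_neg_fun, hK k hK', neg_zero])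
    (by rw [moment_neg_fun, neg_ne_zero]; exact hμ)
  exact ⟨j, fun s hs => by have := hj s hs; rw [boxSum_neg] at this; linarith⟩

theorem moment_omegaShift_top_ne_zero {h : ℤ} {D : Design} (hD : D.OnAlphabet h) (hμ : D.mu ≠ 0) :
    moment (omegaShift h D) (fun _ => 1) ≠ 0 := by
  rw [moment_omegaShift_top hD]
  intro h0
  have hs : star D.mu = 0 := GaussianInt.toComplex_injective (by rw [h0, map_zero])
  exact hμ (by simpa using congrArg star hs)

/-- **CORNER SPREAD, N side (`E ≥ 0`)**: there is a residue `j` such that EVERY one of the 64 boxes with corner sum `j`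
contains a positive ray class … -/
theorem posRay_meets_cornerClass {h : ℤ} {D : Design} (hD : D.OnAlphabet h) (h1 : D.A1) (hE : 0 ≤ E h D)
    (hμ : D.mu ≠ 0) : ∃ j : ZMod 4, ∀ s ∈ cornerClass j, ∃ τ ∈ posRay D, τ ∈ pbox s := by
  obtain ⟨j, hj⟩ := exists_cornerClass_pos (omegaShift h D) (fun k hK => moment_omegaShift_adm hD h1 k hK)
    (moment_omegaShift_top_ne_zero hD hμ)
  refine ⟨j, fun s hs => exists_mem_of_boxSum_pos (omegaShift h D) (posRay D) (fun τ hτ => ?_) s (hj s hs)⟩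
  unfold omegaShift omegaRayR
  have h1' : (omegaRay D τ : ℝ) ≤ 0 := by exact_mod_cast not_lt.mp fun hlt => hτ (mem_posRay.mpr hlt)
  have h2' : (0 : ℝ) ≤ (E h D : ℝ) := by exact_mod_cast hE
  linarith

/-- **CORNER SPREAD, P side (`E ≤ 0`)**: a whole corner class of boxes each containing a negative ray class. -/
theorem negRay_meets_cornerClass {h : ℤ} {D : Design} (hD : D.OnAlphabet h) (h1 : D.A1) (hE : E h D ≤ 0)
    (hμ : D.mu ≠ 0) : ∃ j : ZMod 4, ∀ s ∈ cornerClass j, ∃ τ ∈ negRay D, τ ∈ pbox s := by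
  obtain ⟨j, hj⟩ := exists_cornerClass_neg (omegaShift h D) (fun k hK => moment_omegaShift_adm hD h1 k hK)
    (moment_omegaShift_top_ne_zero hD hμ)
  refine ⟨j, fun s hs => ?_⟩
  have hj' : 0 < boxSum (fun τ => -omegaShift h D τ) s := by rw [boxSum_neg]; linarith [hj s hs]
  refine exists_mem_of_boxSum_pos (fun τ => -omegaShift h D τ) (negRay D) (fun τ hτ => ?_) s hj'
  unfold omegaShift omegaRayR
  have h1' : (0 : ℝ) ≤ (omegaRay D τ : ℝ) := by exact_mod_cast not_lt.mp fun hlt => hτ (mem_negRay.mpr hlt)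
  have h2' : (E h D : ℝ) ≤ 0 := by exact_mod_cast hE
  linarith

/-! ## §3c Who must spread: the sign of `E` from the pair law -/

theorem linZ_vanish (L : List (Cell × ℕ)) (φ : Cell → ℤ) (hφ : ∀ cm ∈ L, 0 < cm.2 → φ cm.1 = 0) : linZ L φ = 0 := by
  induction L with
  | nil => rw [linZ_nil]
  | cons a t ih =>
    rw [linZ_cons, ih fun cm hcm => hφ cm (List.mem_cons_of_mem _ hcm), add_zero]
    rcases Nat.eq_zero_or_pos a.2 with h0 | hpos
    · rw [h0]; simp
    · rw [hφ a List.mem_cons_self hpos, mul_zero]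

/-- if at SOME slot pair `g ≠ g'` no P-cell is off-axis at both slots, then `E ≥ 0` (pair law `E = 4(k^N − k^P)`). -/
theorem E_nonneg_of_P_pairAxis {h : ℤ} {D : Design} (hD : D.OnAlphabet h) (h1 : D.A1) {g g' : Fin 4} (hne : g ≠ g')
    (hP : ∀ c ∈ D.suppP, (c g).isAxis ∨ (c g').isAxis) : 0 ≤ E h D := by
  rw [pair_law_alphabet hD h1 hne]
  have hN : 0 ≤ linZ D.N (pw g g') := linZ_nonneg _ _ fun cm _ _ => pw_nonneg g g' cm.1
  have hP0 : linZ D.P (pw g g') = 0 := linZ_vanish D.P (pw g g') fun cm hcm hpos =>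
    pw_eq_zero_of_pairAxis (hP cm.1 ((mem_suppP_iff D cm.1).mpr ⟨cm.2, hcm, hpos⟩))
  linarith

/-- if at some slot pair no N-cell is off-axis at both slots, then `E ≤ 0`. -/
theorem E_nonpos_of_N_pairAxis {h : ℤ} {D : Design} (hD : D.OnAlphabet h) (h1 : D.A1) {g g' : Fin 4} (hne : g ≠ g')
    (hN : ∀ c ∈ D.suppN, (c g).isAxis ∨ (c g').isAxis) : E h D ≤ 0 := by
  rw [pair_law_alphabet hD h1 hne]
  have hP : 0 ≤ linZ D.P (pw g g') := linZ_nonneg _ _ fun cm _ _ => pw_nonneg g g' cm.1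
  have hN0 : linZ D.N (pw g g') = 0 := linZ_vanish D.N (pw g g') fun cm hcm hpos =>
    pw_eq_zero_of_pairAxis (hN cm.1 ((mem_suppN_iff D cm.1).mpr ⟨cm.2, hcm, hpos⟩))
  linarith

/-- **WHO MUST SPREAD, I**: if the P-support is pair-axis at some slot pair, the N side has `≥ 14` positive ray classes. -/
theorem fourteen_le_posRay_of_P_pairAxis {h : ℤ} {D : Design} (hD : D.OnAlphabet h) (h1 : D.A1) {g g' : Fin 4}
    (hne : g ≠ g') (hP : ∀ c ∈ D.suppP, (c g).isAxis ∨ (c g').isAxis) (hμ : D.mu ≠ 0) : 14 ≤ (posRay D).card :=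
  fourteen_le_posRay hD h1 (E_nonneg_of_P_pairAxis hD h1 hne hP) hμ

/-- **WHO MUST SPREAD, II**: if the N-support is pair-axis at some slot pair (e.g. every N-cell has at most one off-axis
letter), the P side has `≥ 14` negative ray classes. -/
theorem fourteen_le_negRay_of_N_pairAxis {h : ℤ} {D : Design} (hD : D.OnAlphabet h) (h1 : D.A1) {g g' : Fin 4}
    (hne : g ≠ g') (hN : ∀ c ∈ D.suppN, (c g).isAxis ∨ (c g').isAxis) (hμ : D.mu ≠ 0) : 14 ≤ (negRay D).card :=
  fourteen_le_negRay hD h1 (E_nonpos_of_N_pairAxis hD h1 hne hN) hμ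

/-! ## §4 Positivity transfer: who pays for a class -/

theorem exists_pos_of_linZ_pos (L : List (Cell × ℕ)) (φ : Cell → ℤ) (hφ : ∀ c, 0 ≤ φ c) (hL : 0 < linZ L φ) :
    ∃ cm ∈ L, 0 < cm.2 ∧ 0 < φ cm.1 := by
  induction L with
  | nil => rw [linZ_nil] at hL; exact absurd hL (lt_irrefl 0)
  | cons a t ih =>
    rw [linZ_cons] at hL
    by_cases ha : 0 < (a.2 : ℤ) * φ a.1
    · have h2 : 0 < a.2 := by
        rcases Nat.eq_zero_or_pos a.2 with h0 | h0
        · rw [h0] at ha; simp at ha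
        · exact h0
      have h3 : 0 < φ a.1 := by
        by_contra hc
        have h4 : φ a.1 = 0 := le_antisymm (not_lt.mp hc) (hφ _)
        rw [h4, mul_zero] at ha
        exact lt_irrefl _ ha
      exact ⟨a, List.mem_cons_self, h2, h3⟩
    · have ht : 0 < linZ t φ := by
        have : (0 : ℤ) ≤ (a.2 : ℤ) * φ a.1 := mul_nonneg (Int.natCast_nonneg _) (hφ _)
        push Not at ha
        linarith
      obtain ⟨cm, hcm, h2, h3⟩ := ih ht
      exact ⟨cm, List.mem_cons_of_mem _ hcm, h2, h3⟩

/-- a POSITIVE ray class is touched by an N-cell of the support … -/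
theorem exists_suppN_of_posRay {D : Design} {τ : PT} (hτ : 0 < omegaRay D τ) : ∃ c ∈ D.suppN, 0 < wray τ c := by
  unfold omegaRay at hτ
  have hP : 0 ≤ linZ D.P (wray τ) := linZ_nonneg _ _ fun cm _ _ => wray_nonneg τ cm.1
  have hN : 0 < linZ D.N (wray τ) := by linarith
  obtain ⟨cm, hcm, hpos, hw⟩ := exists_pos_of_linZ_pos D.N (wray τ) (wray_nonneg τ) hN
  exact ⟨cm.1, (mem_suppN_iff D cm.1).mpr ⟨cm.2, hcm, hpos⟩, hw⟩

/-- … and a NEGATIVE one by a P-cell. -/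
theorem exists_suppP_of_negRay {D : Design} {τ : PT} (hτ : omegaRay D τ < 0) : ∃ c ∈ D.suppP, 0 < wray τ c := by
  unfold omegaRay at hτ
  have hN : 0 ≤ linZ D.N (wray τ) := linZ_nonneg _ _ fun cm _ _ => wray_nonneg τ cm.1
  have hP : 0 < linZ D.P (wray τ) := by linarith
  obtain ⟨cm, hcm, hpos, hw⟩ := exists_pos_of_linZ_pos D.P (wray τ) (wray_nonneg τ) hP
  exact ⟨cm.1, (mem_suppP_iff D cm.1).mpr ⟨cm.2, hcm, hpos⟩, hw⟩

/-- a cell TOUCHES `τ` (`w_τ(c) > 0`) iff every letter has a positive component along its ray `τ_f`, i.e. lies in the open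
half-plane `⟨β, i^{τ_f}⟩ > 0`. -/
theorem wray_pos_iff (τ : PT) (c : Cell) : 0 < wray τ c ↔ ∀ f, 0 < lam (c f) (τ f) := by
  unfold wray
  constructor
  · intro hw f
    by_contra hf
    have h0 : lam (c f) (τ f) = 0 := le_antisymm (not_lt.mp hf) (lam_nonneg _ _)
    rw [Finset.prod_eq_zero (Finset.mem_univ f) h0] at hw
    exact lt_irrefl _ hw
  · intro hw
    exact Finset.prod_pos fun f _ => hw f

/-- the open half-planes: `λ(ℓ,p) > 0 ⟺ x > 0, y > 0, x < 0, y < 0` for `p = 0, 1, 2, 3`. -/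
theorem lam_pos_iff_zero (ℓ : Letter) : 0 < lam ℓ 0 ↔ 0 < ℓ.x := by rw [lam_zero]; simp
theorem lam_pos_iff_one (ℓ : Letter) : 0 < lam ℓ 1 ↔ 0 < ℓ.y := by rw [lam_one]; simp
theorem lam_pos_iff_two (ℓ : Letter) : 0 < lam ℓ 2 ↔ ℓ.x < 0 := by rw [lam_two]; simp
theorem lam_pos_iff_three (ℓ : Letter) : 0 < lam ℓ 3 ↔ ℓ.y < 0 := by rw [lam_three]; simp

/-- a letter touches at most the two rays bounding its quadrant: `{p : λ(ℓ,p) > 0} ⊆ {p₀, p₀ + 1}`. -/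
theorem letter_corner (ℓ : Letter) : ∃ p₀ : ZMod 4, ∀ p, 0 < lam ℓ p → p = p₀ ∨ p = p₀ + 1 := by
  rcases lt_or_ge 0 ℓ.x with hx | hx <;> rcases lt_or_ge 0 ℓ.y with hy | hy
  · refine ⟨0, fun p hp => ?_⟩
    rcases zmod4_cases p with rfl | rfl | rfl | rfl
    · exact Or.inl rfl
    · exact Or.inr (by decide)
    · rw [lam_two_eq_zero ℓ hx.le] at hp; exact absurd hp (lt_irrefl 0)
    · rw [lam_three_eq_zero ℓ hy.le] at hp; exact absurd hp (lt_irrefl 0)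
  · refine ⟨3, fun p hp => ?_⟩
    rcases zmod4_cases p with rfl | rfl | rfl | rfl
    · exact Or.inr (by decide)
    · rw [lam_one_eq_zero ℓ hy] at hp; exact absurd hp (lt_irrefl 0)
    · rw [lam_two_eq_zero ℓ hx.le] at hp; exact absurd hp (lt_irrefl 0)
    · exact Or.inl rfl
  · refine ⟨1, fun p hp => ?_⟩
    rcases zmod4_cases p with rfl | rfl | rfl | rfl
    · rw [lam_zero_eq_zero ℓ hx] at hp; exact absurd hp (lt_irrefl 0)
    · exact Or.inl rfl
    · exact Or.inr (by decide)
    · rw [lam_three_eq_zero ℓ hy.le] at hp; exact absurd hp (lt_irrefl 0)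
  · refine ⟨2, fun p hp => ?_⟩
    rcases zmod4_cases p with rfl | rfl | rfl | rfl
    · rw [lam_zero_eq_zero ℓ hx] at hp; exact absurd hp (lt_irrefl 0)
    · rw [lam_one_eq_zero ℓ hy] at hp; exact absurd hp (lt_irrefl 0)
    · exact Or.inl rfl
    · exact Or.inr (by decide)

/-- an AXIS letter touches at most its own ray. -/
theorem letter_corner_axis {ℓ : Letter} (hax : ℓ.isAxis) : ∃ p₀ : ZMod 4, ∀ p, 0 < lam ℓ p → p = p₀ := by
  unfold Letter.isAxis at hax
  rcases mul_eq_zero.mp hax with hx | hy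
  · rcases lt_or_ge 0 ℓ.y with hy | hy
    · refine ⟨1, fun p hp => ?_⟩
      rcases zmod4_cases p with rfl | rfl | rfl | rfl
      · rw [lam_zero_eq_zero ℓ hx.le] at hp; exact absurd hp (lt_irrefl 0)
      · rfl
      · rw [lam_two_eq_zero ℓ hx.ge] at hp; exact absurd hp (lt_irrefl 0)
      · rw [lam_three_eq_zero ℓ hy.le] at hp; exact absurd hp (lt_irrefl 0)
    · refine ⟨3, fun p hp => ?_⟩
      rcases zmod4_cases p with rfl | rfl | rfl | rfl
      · rw [lam_zero_eq_zero ℓ hx.le] at hp; exact absurd hp (lt_irrefl 0)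
      · rw [lam_one_eq_zero ℓ hy] at hp; exact absurd hp (lt_irrefl 0)
      · rw [lam_two_eq_zero ℓ hx.ge] at hp; exact absurd hp (lt_irrefl 0)
      · rfl
  · rcases lt_or_ge 0 ℓ.x with hx | hx
    · refine ⟨0, fun p hp => ?_⟩
      rcases zmod4_cases p with rfl | rfl | rfl | rfl
      · rfl
      · rw [lam_one_eq_zero ℓ hy.le] at hp; exact absurd hp (lt_irrefl 0)
      · rw [lam_two_eq_zero ℓ hx.le] at hp; exact absurd hp (lt_irrefl 0)
      · rw [lam_three_eq_zero ℓ hy.ge] at hp; exact absurd hp (lt_irrefl 0)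
    · refine ⟨2, fun p hp => ?_⟩
      rcases zmod4_cases p with rfl | rfl | rfl | rfl
      · rw [lam_zero_eq_zero ℓ hx] at hp; exact absurd hp (lt_irrefl 0)
      · rw [lam_one_eq_zero ℓ hy.le] at hp; exact absurd hp (lt_irrefl 0)
      · rfl
      · rw [lam_three_eq_zero ℓ hy.ge] at hp; exact absurd hp (lt_irrefl 0)

/-- the TOUCH SET of a cell: the classes it can pay for. -/
def touch (c : Cell) : Finset PT := Finset.univ.filter fun τ => 0 < wray τ c

theorem mem_touch {c : Cell} {τ : PT} : τ ∈ touch c ↔ 0 < wray τ c := by simp [touch]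

/-- the touch set lies in a CORNER BOX `∏_f {p_f, p_f + 1}`. -/
theorem touch_corner (c : Cell) : ∃ p₀ : PT, ∀ τ : PT, 0 < wray τ c → ∀ f, τ f = p₀ f ∨ τ f = p₀ f + 1 := by
  choose p₀ hp₀ using fun f => letter_corner (c f)
  exact ⟨p₀, fun τ hτ f => hp₀ f (τ f) ((wray_pos_iff τ c).mp hτ f)⟩

theorem self_ne_add_one (p : ZMod 4) : p ≠ p + 1 := by revert p; decide

/-- **a cell touches at most 16 classes** … -/
theorem touch_card_le (c : Cell) : (touch c).card ≤ 16 := by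
  obtain ⟨p₀, hp₀⟩ := touch_corner c
  calc (touch c).card
      ≤ ((Finset.univ : Finset (Fin 4 → Bool)).image
          fun ε : Fin 4 → Bool => (fun f => p₀ f + if ε f then 1 else 0 : PT)).card := by
        refine Finset.card_le_card fun τ hτ => ?_
        rw [mem_touch] at hτ
        rw [Finset.mem_image]
        refine ⟨fun f => decide (τ f = p₀ f + 1), Finset.mem_univ _, funext fun f => ?_⟩
        rcases hp₀ τ hτ f with hf | hf
        · simp [hf, self_ne_add_one (p₀ f)]
        · simp [hf]
    _ ≤ (Finset.univ : Finset (Fin 4 → Bool)).card := Finset.card_image_le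
    _ = 16 := by simp

/-- … and an AXIS cell at most one. -/
theorem touch_card_le_one_of_axisCell {c : Cell} (hax : AxisCell c) : (touch c).card ≤ 1 := by
  choose p₀ hp₀ using fun f => letter_corner_axis (hax f)
  refine Finset.card_le_one.mpr fun τ hτ τ' hτ' => ?_
  rw [mem_touch, wray_pos_iff] at hτ hτ'
  exact funext fun f => (hp₀ f (τ f) (hτ f)).trans (hp₀ f (τ' f) (hτ' f)).symm

/-- the positive classes are covered by the touch sets of the N-support … -/
theorem posRay_subset (D : Design) : posRay D ⊆ D.suppN.toFinset.biUnion touch := by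
  intro τ hτ
  obtain ⟨c, hc, hw⟩ := exists_suppN_of_posRay (mem_posRay.mp hτ)
  exact Finset.mem_biUnion.mpr ⟨c, List.mem_toFinset.mpr hc, mem_touch.mpr hw⟩

/-- … the negative ones by those of the P-support. -/
theorem negRay_subset (D : Design) : negRay D ⊆ D.suppP.toFinset.biUnion touch := by
  intro τ hτ
  obtain ⟨c, hc, hw⟩ := exists_suppP_of_negRay (mem_negRay.mp hτ)
  exact Finset.mem_biUnion.mpr ⟨c, List.mem_toFinset.mpr hc, mem_touch.mpr hw⟩

/-- **THE PRICE OF THE CLASSES, N side (`E ≥ 0`)**: `14 ≤ Σ_{N-support cells} #touch(c)` (each term `≤ 16`, `≤ 1` for an axis cell). -/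
theorem fourteen_le_sum_touch_N {h : ℤ} {D : Design} (hD : D.OnAlphabet h) (h1 : D.A1) (hE : 0 ≤ E h D) (hμ : D.mu ≠ 0) :
    14 ≤ ∑ c ∈ D.suppN.toFinset, (touch c).card :=
  (fourteen_le_posRay hD h1 hE hμ).trans ((Finset.card_le_card (posRay_subset D)).trans Finset.card_biUnion_le)

/-- **THE PRICE OF THE CLASSES, P side (`E ≤ 0`)**: `14 ≤ Σ_{P-support cells} #touch(c)`. -/
theorem fourteen_le_sum_touch_P {h : ℤ} {D : Design} (hD : D.OnAlphabet h) (h1 : D.A1) (hE : E h D ≤ 0) (hμ : D.mu ≠ 0) :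
    14 ≤ ∑ c ∈ D.suppP.toFinset, (touch c).card :=
  (fourteen_le_negRay hD h1 hE hμ).trans ((Finset.card_le_card (negRay_subset D)).trans Finset.card_biUnion_le)

/-- the AXIS SPECIAL CASE recovered and extended: if `E ≥ 0` and every N-support cell is an axis cell, the N-support has `≥ 14`
cells (cf. `AxisPhaseTorus`: there both sides are axis and `E = 0`). -/
theorem fourteen_le_card_suppN_of_axisN {h : ℤ} {D : Design} (hD : D.OnAlphabet h) (h1 : D.A1) (hE : 0 ≤ E h D)
    (hμ : D.mu ≠ 0) (hax : ∀ c ∈ D.suppN, AxisCell c) : 14 ≤ D.suppN.toFinset.card := by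
  have h14 := fourteen_le_sum_touch_N hD h1 hE hμ
  have hle : ∑ c ∈ D.suppN.toFinset, (touch c).card ≤ ∑ c ∈ D.suppN.toFinset, 1 :=
    Finset.sum_le_sum fun c hc => touch_card_le_one_of_axisCell (hax c (List.mem_toFinset.mp hc))
  rw [Finset.sum_const, smul_eq_mul, mul_one] at hle
  exact h14.trans hle

/-- the mirror: `E ≤ 0` and an axis P-support force `≥ 14` P-cells. -/
theorem fourteen_le_card_suppP_of_axisP {h : ℤ} {D : Design} (hD : D.OnAlphabet h) (h1 : D.A1) (hE : E h D ≤ 0)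
    (hμ : D.mu ≠ 0) (hax : ∀ c ∈ D.suppP, AxisCell c) : 14 ≤ D.suppP.toFinset.card := by
  have h14 := fourteen_le_sum_touch_P hD h1 hE hμ
  have hle : ∑ c ∈ D.suppP.toFinset, (touch c).card ≤ ∑ c ∈ D.suppP.toFinset, 1 :=
    Finset.sum_le_sum fun c hc => touch_card_le_one_of_axisCell (hax c (List.mem_toFinset.mp hc))
  rw [Finset.sum_const, smul_eq_mul, mul_one] at hle
  exact h14.trans hle

/-! ## §4b The corner spread law: touch sets must meet a whole residue class of boxes -/

theorem touch_subset_pbox (c : Cell) : ∃ p₀ : PT, touch c ⊆ pbox p₀ := by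
  obtain ⟨p₀, hp₀⟩ := touch_corner c
  exact ⟨p₀, fun τ hτ => mem_pbox.mpr (hp₀ τ (mem_touch.mp hτ))⟩

/-- two boxes meet only if their corners differ by a vector of `{0, 1, −1}⁴`. -/
theorem corner_sub_of_meet {s p τ : PT} (hs : τ ∈ pbox s) (hp : τ ∈ pbox p) (f : Fin 4) :
    s f - p f = 0 ∨ s f - p f = 1 ∨ s f - p f = 3 := by
  rcases (mem_pbox.mp hs) f with h1 | h1 <;> rcases (mem_pbox.mp hp) f with h2 | h2
  · left; rw [← h1, ← h2, sub_self]
  · right; left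
    have e1 : s f - p f = 1 := by rw [← h1, h2]; ring
    exact e1
  · right; right
    have e1 : s f - p f = -1 := by rw [← h2, h1]; ring
    rw [e1]; decide
  · left
    have e1 : s f = p f := add_right_cancel (h1.symm.trans h2)
    rw [e1, sub_self]

/-- bounded fact: the vectors of `{0, 1, 3}⁴ ⊂ (ℤ/4)⁴` with a prescribed coordinate sum number at most `21`
(`19+1+1` for residue `0`, `16+4` for `±1`, `10+10` for `2`). -/
theorem card_near_le (r : ZMod 4) :
    ((Finset.univ : Finset PT).filter fun δ => (∀ f, δ f = 0 ∨ δ f = 1 ∨ δ f = 3) ∧ ∑ f, δ f = r).card ≤ 21 := by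
  revert r; decide +kernel

/-- the boxes of ONE corner class whose corner is `{0,1,−1}`-near a given corner `p`: at most `21`. -/
theorem card_cornerClass_near_le (j : ZMod 4) (p : PT) :
    ((cornerClass j).filter fun s => ∀ f, s f - p f = 0 ∨ s f - p f = 1 ∨ s f - p f = 3).card ≤ 21 := by
  calc ((cornerClass j).filter fun s => ∀ f, s f - p f = 0 ∨ s f - p f = 1 ∨ s f - p f = 3).card
      ≤ ((Finset.univ : Finset PT).filter
          fun δ => (∀ f, δ f = 0 ∨ δ f = 1 ∨ δ f = 3) ∧ ∑ f, δ f = j - ∑ f, p f).card := by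
        apply Finset.card_le_card_of_injOn (fun s => s - p)
        · intro s hs
          have hs' : s ∈ (cornerClass j).filter fun s => ∀ f, s f - p f = 0 ∨ s f - p f = 1 ∨ s f - p f = 3 := by
            exact_mod_cast hs
          obtain ⟨hsj, hnear⟩ := Finset.mem_filter.1 hs'
          have goal : (s - p) ∈ (Finset.univ : Finset PT).filter
              fun δ => (∀ f, δ f = 0 ∨ δ f = 1 ∨ δ f = 3) ∧ ∑ f, δ f = j - ∑ f, p f := by
            rw [Finset.mem_filter]
            refine ⟨Finset.mem_univ _, fun f => by simpa only [Pi.sub_apply] using hnear f, ?_⟩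
            simp only [Pi.sub_apply, Finset.sum_sub_distrib, sum_of_mem_cornerClass hsj]
          exact_mod_cast goal
        · intro s _ s' _ hss'
          exact sub_left_injective hss'
    _ ≤ 21 := card_near_le _

/-- **each cell serves at most `21` boxes of a corner class** (its touch set lies in one box) … -/
theorem card_boxes_met_le (c : Cell) (j : ZMod 4) :
    ((cornerClass j).filter fun s => ∃ τ ∈ touch c, τ ∈ pbox s).card ≤ 21 := by
  obtain ⟨p, hp⟩ := touch_subset_pbox c
  calc ((cornerClass j).filter fun s => ∃ τ ∈ touch c, τ ∈ pbox s).card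
      ≤ ((cornerClass j).filter fun s => ∀ f, s f - p f = 0 ∨ s f - p f = 1 ∨ s f - p f = 3).card := by
        refine Finset.card_le_card fun s hs => ?_
        rw [Finset.mem_filter] at hs ⊢
        obtain ⟨hsj, τ, hτ, hτs⟩ := hs
        exact ⟨hsj, corner_sub_of_meet hτs (hp hτ)⟩
    _ ≤ 21 := card_cornerClass_near_le j p

/-- … and an AXIS cell at most `6` (its touch set is one point). -/
theorem card_boxes_met_le_six_of_axisCell {c : Cell} (hax : AxisCell c) (j : ZMod 4) :
    ((cornerClass j).filter fun s => ∃ τ ∈ touch c, τ ∈ pbox s).card ≤ 6 := by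
  rcases Finset.eq_empty_or_nonempty (touch c) with h0 | ⟨a, ha⟩
  · have : ((cornerClass j).filter fun s => ∃ τ ∈ touch c, τ ∈ pbox s) = ∅ := by
      refine Finset.filter_false_of_mem fun s _ => ?_
      rintro ⟨τ, hτ, -⟩
      rw [h0] at hτ
      exact absurd hτ (Finset.notMem_empty τ)
    rw [this, Finset.card_empty]; norm_num
  · have hsub : ∀ τ ∈ touch c, τ = a := fun τ hτ =>
      Finset.card_le_one.mp (touch_card_le_one_of_axisCell hax) τ hτ a ha
    calc ((cornerClass j).filter fun s => ∃ τ ∈ touch c, τ ∈ pbox s).card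
        ≤ ((cornerClass j).filter fun s => a ∈ pbox s).card := by
          refine Finset.card_le_card fun s hs => ?_
          rw [Finset.mem_filter] at hs ⊢
          obtain ⟨hsj, τ, hτ, hτs⟩ := hs
          exact ⟨hsj, hsub τ hτ ▸ hτs⟩
      _ ≤ 6 := card_corners_containing_le j a

/-- **THE CORNER SPREAD LAW, N side (`E ≥ 0`)**: for some residue `j`, `64 ≤ Σ_{N-cells} #(boxes of class j met by
touch c)`, each term `≤ 21` (`≤ 6` for an axis cell): the corner boxes of the N-cells `{0,±1}`-cover a whole residue class. -/
theorem sixtyfour_le_sum_boxes_N {h : ℤ} {D : Design} (hD : D.OnAlphabet h) (h1 : D.A1) (hE : 0 ≤ E h D)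
    (hμ : D.mu ≠ 0) : ∃ j : ZMod 4,
      64 ≤ ∑ c ∈ D.suppN.toFinset, ((cornerClass j).filter fun s => ∃ τ ∈ touch c, τ ∈ pbox s).card := by
  obtain ⟨j, hj⟩ := posRay_meets_cornerClass hD h1 hE hμ
  refine ⟨j, ?_⟩
  have hcov : cornerClass j ⊆ D.suppN.toFinset.biUnion
      fun c => (cornerClass j).filter fun s => ∃ τ ∈ touch c, τ ∈ pbox s := by
    intro s hs
    obtain ⟨τ, hτ, hτs⟩ := hj s hs
    obtain ⟨c, hc, hw⟩ := exists_suppN_of_posRay (mem_posRay.mp hτ)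
    exact Finset.mem_biUnion.mpr ⟨c, List.mem_toFinset.mpr hc, Finset.mem_filter.mpr ⟨hs, τ, mem_touch.mpr hw, hτs⟩⟩
  calc 64 = (cornerClass j).card := (cornerClass_card j).symm
    _ ≤ _ := (Finset.card_le_card hcov).trans Finset.card_biUnion_le

/-- the P side (`E ≤ 0`). -/
theorem sixtyfour_le_sum_boxes_P {h : ℤ} {D : Design} (hD : D.OnAlphabet h) (h1 : D.A1) (hE : E h D ≤ 0)
    (hμ : D.mu ≠ 0) : ∃ j : ZMod 4,
      64 ≤ ∑ c ∈ D.suppP.toFinset, ((cornerClass j).filter fun s => ∃ τ ∈ touch c, τ ∈ pbox s).card := by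
  obtain ⟨j, hj⟩ := negRay_meets_cornerClass hD h1 hE hμ
  refine ⟨j, ?_⟩
  have hcov : cornerClass j ⊆ D.suppP.toFinset.biUnion
      fun c => (cornerClass j).filter fun s => ∃ τ ∈ touch c, τ ∈ pbox s := by
    intro s hs
    obtain ⟨τ, hτ, hτs⟩ := hj s hs
    obtain ⟨c, hc, hw⟩ := exists_suppP_of_negRay (mem_negRay.mp hτ)
    exact Finset.mem_biUnion.mpr ⟨c, List.mem_toFinset.mpr hc, Finset.mem_filter.mpr ⟨hs, τ, mem_touch.mpr hw, hτs⟩⟩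
  calc 64 = (cornerClass j).card := (cornerClass_card j).symm
    _ ≤ _ := (Finset.card_le_card hcov).trans Finset.card_biUnion_le

/-- **≥ 4 N-CELLS when `E ≥ 0`** (`3 · 21 < 64`; for an axis N-support the same count gives `≥ 11`, the corank-10 law). -/
theorem four_le_card_suppN {h : ℤ} {D : Design} (hD : D.OnAlphabet h) (h1 : D.A1) (hE : 0 ≤ E h D) (hμ : D.mu ≠ 0) :
    4 ≤ D.suppN.toFinset.card := by
  obtain ⟨j, h64⟩ := sixtyfour_le_sum_boxes_N hD h1 hE hμ
  have hle : ∑ c ∈ D.suppN.toFinset, ((cornerClass j).filter fun s => ∃ τ ∈ touch c, τ ∈ pbox s).card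
      ≤ ∑ c ∈ D.suppN.toFinset, 21 := Finset.sum_le_sum fun c _ => card_boxes_met_le c j
  rw [Finset.sum_const, smul_eq_mul] at hle
  omega

/-- **≥ 4 P-CELLS when `E ≤ 0`.** -/
theorem four_le_card_suppP {h : ℤ} {D : Design} (hD : D.OnAlphabet h) (h1 : D.A1) (hE : E h D ≤ 0) (hμ : D.mu ≠ 0) :
    4 ≤ D.suppP.toFinset.card := by
  obtain ⟨j, h64⟩ := sixtyfour_le_sum_boxes_P hD h1 hE hμ
  have hle : ∑ c ∈ D.suppP.toFinset, ((cornerClass j).filter fun s => ∃ τ ∈ touch c, τ ∈ pbox s).card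
      ≤ ∑ c ∈ D.suppP.toFinset, 21 := Finset.sum_le_sum fun c _ => card_boxes_met_le c j
  rw [Finset.sum_const, smul_eq_mul] at hle
  omega

/-! ## §5a Letter-level null-step geometry (inlined from `QuadrantSlide.lean` §1–§2, which is in the tree but not yet built
on the farm at the time of writing; same statements, same proofs, nested under `QS` to avoid name clashes) -/

namespace QS

theorem sq_sub_eq_sq_abs_sub {a b : ℤ} (hab : 0 ≤ a * b) : (a - b) ^ 2 = (|a| - |b|) ^ 2 := by
  have h1 : |a| * |b| = a * b := by rw [← abs_mul]; exact abs_of_nonneg hab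
  have ha : |a| ^ 2 = a ^ 2 := sq_abs a
  have hb : |b| ^ 2 = b ^ 2 := sq_abs b
  nlinarith [h1, ha, hb]

theorem eq_of_abs_eq_of_mul_nonneg {a b : ℤ} (hab : 0 ≤ a * b) (h : |a| = |b|) : a = b := by
  rcases abs_eq_abs.mp h with h' | h'
  · exact h'
  · subst h'
    have : b * b ≤ 0 := by nlinarith [hab]
    have hb : b = 0 := by nlinarith [mul_self_nonneg b]
    simp [hb]

/-- `Δ = a' − a = (|x| − |x'|) + (|y| − |y'|)`. -/
theorem delta_eq {h : ℤ} {ℓ ℓ' : Letter} (hℓ : ℓ.OnAlphabet h) (hℓ' : ℓ'.OnAlphabet h) :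
    ℓ'.a - ℓ.a = (|ℓ.x| - |ℓ'.x|) + (|ℓ.y| - |ℓ'.y|) := by
  have e1 := hℓ.1; have e2 := hℓ'.1
  unfold Letter.height at e1 e2
  linarith

/-- QUADRANT SLIDE: a null step inside one closed quadrant is axis-parallel and lengthens one coordinate. -/
theorem quadrant_slide {h : ℤ} {ℓ ℓ' : Letter} (hℓ : ℓ.OnAlphabet h) (hℓ' : ℓ'.OnAlphabet h)
    (hx : 0 ≤ ℓ.x * ℓ'.x) (hy : 0 ≤ ℓ.y * ℓ'.y) (hs : NullStep ℓ ℓ') :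
    (ℓ.x = ℓ'.x ∧ |ℓ'.y| < |ℓ.y|) ∨ (ℓ.y = ℓ'.y ∧ |ℓ'.x| < |ℓ.x|) := by
  obtain ⟨hlt, heq⟩ := hs
  have hΔ := delta_eq hℓ hℓ'
  have hP : (ℓ'.x - ℓ.x) ^ 2 = (|ℓ.x| - |ℓ'.x|) ^ 2 := by
    rw [show (ℓ'.x - ℓ.x) ^ 2 = (ℓ.x - ℓ'.x) ^ 2 by ring]; exact sq_sub_eq_sq_abs_sub hx
  have hQ : (ℓ'.y - ℓ.y) ^ 2 = (|ℓ.y| - |ℓ'.y|) ^ 2 := by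
    rw [show (ℓ'.y - ℓ.y) ^ 2 = (ℓ.y - ℓ'.y) ^ 2 by ring]; exact sq_sub_eq_sq_abs_sub hy
  set P := |ℓ.x| - |ℓ'.x| with hPdef
  set Q := |ℓ.y| - |ℓ'.y| with hQdef
  have hPQ : P * Q = 0 := by
    have : P ^ 2 + Q ^ 2 = (P + Q) ^ 2 := by rw [← hP, ← hQ, heq, hΔ]
    nlinarith [this]
  rcases mul_eq_zero.mp hPQ with hP0 | hQ0
  · left
    refine ⟨eq_of_abs_eq_of_mul_nonneg hx (by linarith), ?_⟩
    have : 0 < Q := by linarith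
    linarith
  · right
    refine ⟨eq_of_abs_eq_of_mul_nonneg hy (by linarith), ?_⟩
    have : 0 < P := by linarith
    linarith

theorem abs_sub_abs_of_mul_neg {a b : ℤ} (hab : a * b < 0) : |a| - |b| = |a - b| - 2 * |b| := by
  rcases lt_trichotomy a 0 with ha | ha | ha
  · have hb : 0 < b := by nlinarith
    rw [abs_of_neg ha, abs_of_pos hb, abs_of_neg (by linarith : a - b < 0)]; ring
  · subst ha; simp at hab
  · have hb : b < 0 := by nlinarith
    rw [abs_of_pos ha, abs_of_neg hb, abs_of_pos (by linarith : 0 < a - b)]; ring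

theorem two_mul_abs_le_of_cross_x {h : ℤ} {ℓ ℓ' : Letter} (hℓ : ℓ.OnAlphabet h) (hℓ' : ℓ'.OnAlphabet h)
    (hx : ℓ.x * ℓ'.x < 0) : 2 * |ℓ'.x| ≤ |ℓ.x - ℓ'.x| + |ℓ.y - ℓ'.y| - (ℓ'.a - ℓ.a) := by
  have hΔ := delta_eq hℓ hℓ'
  have h1 := abs_sub_abs_of_mul_neg hx
  have h2 := abs_sub_abs_le_abs_sub ℓ.y ℓ'.y
  linarith

/-- bounded fact: a Pythagorean triple `p² + q² = Δ²`, `pq ≠ 0`, `0 < Δ ≤ 14` has slack `|p| + |q| − Δ ≤ 4`. -/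
theorem slack_le_four_bdd :
    ∀ Δ ∈ Finset.Icc (1 : ℤ) 14, ∀ p ∈ Finset.Icc (-14 : ℤ) 14, ∀ q ∈ Finset.Icc (-14 : ℤ) 14,
      p ^ 2 + q ^ 2 = Δ ^ 2 → p ≠ 0 → q ≠ 0 → |p| + |q| - Δ ≤ 4 := by
  decide +kernel

theorem slack_le_four {p q Δ : ℤ} (hΔ0 : 0 < Δ) (hΔ : Δ ≤ 14) (hpy : p ^ 2 + q ^ 2 = Δ ^ 2) (hp : p ≠ 0) (hq : q ≠ 0) :
    |p| + |q| - Δ ≤ 4 := by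
  have hpa : |p| ≤ Δ := by nlinarith [sq_abs p, abs_nonneg p, sq_nonneg q]
  have hqa : |q| ≤ Δ := by nlinarith [sq_abs q, abs_nonneg q, sq_nonneg p]
  have hpI : p ∈ Finset.Icc (-14 : ℤ) 14 := by
    rw [Finset.mem_Icc]; constructor <;> linarith [abs_le.mp (le_trans hpa hΔ) |>.1, abs_le.mp (le_trans hpa hΔ) |>.2]
  have hqI : q ∈ Finset.Icc (-14 : ℤ) 14 := by
    rw [Finset.mem_Icc]; constructor <;> linarith [abs_le.mp (le_trans hqa hΔ) |>.1, abs_le.mp (le_trans hqa hΔ) |>.2]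
  have hΔI : Δ ∈ Finset.Icc (1 : ℤ) 14 := by rw [Finset.mem_Icc]; constructor <;> linarith
  exact slack_le_four_bdd Δ hΔI p hpI q hqI hpy hp hq

theorem nullStep_pyth {ℓ ℓ' : Letter} (hs : NullStep ℓ ℓ') :
    (ℓ.x - ℓ'.x) ^ 2 + (ℓ.y - ℓ'.y) ^ 2 = (ℓ'.a - ℓ.a) ^ 2 := by
  have := hs.2; nlinarith [this]

theorem delta_le {h : ℤ} {ℓ ℓ' : Letter} (hℓ : ℓ.OnAlphabet h) (hℓ' : ℓ'.OnAlphabet h) : ℓ'.a - ℓ.a ≤ h := by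
  have e2 := hℓ'.1
  unfold Letter.height at e2
  linarith [hℓ.2, abs_nonneg ℓ'.x, abs_nonneg ℓ'.y]

/-- crossed coordinates are small (`h ≤ 14`): `x·x' < 0 ⇒ |x'| ≤ 2`. -/
theorem cross_coord_le_two_x {h : ℤ} (hh : h ≤ 14) {ℓ ℓ' : Letter} (hℓ : ℓ.OnAlphabet h) (hℓ' : ℓ'.OnAlphabet h)
    (hs : NullStep ℓ ℓ') (hx : ℓ.x * ℓ'.x < 0) : |ℓ'.x| ≤ 2 := by
  have h2 := two_mul_abs_le_of_cross_x hℓ hℓ' hx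
  have hpy := nullStep_pyth hs
  have hΔ0 : 0 < ℓ'.a - ℓ.a := by linarith [hs.1]
  have hΔ : ℓ'.a - ℓ.a ≤ 14 := le_trans (delta_le hℓ hℓ') hh
  have hp : ℓ.x - ℓ'.x ≠ 0 := by
    intro h0
    have : ℓ.x = ℓ'.x := by linarith
    rw [this] at hx
    nlinarith [mul_self_nonneg ℓ'.x]
  by_cases hq : ℓ.y - ℓ'.y = 0
  · have hq' : |ℓ.y - ℓ'.y| = 0 := by rw [hq]; simp
    have hpΔ : |ℓ.x - ℓ'.x| = ℓ'.a - ℓ.a := by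
      have hsq : (ℓ.x - ℓ'.x) ^ 2 = (ℓ'.a - ℓ.a) ^ 2 := by rw [hq] at hpy; simpa using hpy
      have h3 : |ℓ.x - ℓ'.x| = |ℓ'.a - ℓ.a| := by
        exact abs_eq_abs.mpr (by
          have h4 : (ℓ.x - ℓ'.x - (ℓ'.a - ℓ.a)) * (ℓ.x - ℓ'.x + (ℓ'.a - ℓ.a)) = 0 := by nlinarith [hsq]
          rcases mul_eq_zero.mp h4 with h5 | h5
          · exact Or.inl (by linarith)
          · exact Or.inr (by linarith))
      rw [h3, abs_of_pos hΔ0]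
    have : 2 * |ℓ'.x| ≤ 0 := by linarith
    linarith [abs_nonneg ℓ'.x]
  · have := slack_le_four hΔ0 hΔ hpy hp hq
    linarith

/-- the `y` version. -/
theorem cross_coord_le_two_y {h : ℤ} (hh : h ≤ 14) {ℓ ℓ' : Letter} (hℓ : ℓ.OnAlphabet h) (hℓ' : ℓ'.OnAlphabet h)
    (hs : NullStep ℓ ℓ') (hy : ℓ.y * ℓ'.y < 0) : |ℓ'.y| ≤ 2 := by
  have hsw : NullStep (⟨ℓ.a, ℓ.y, ℓ.x⟩ : Letter) ⟨ℓ'.a, ℓ'.y, ℓ'.x⟩ := by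
    obtain ⟨h1, h2⟩ := hs; exact ⟨h1, by simp only at h2 ⊢; linarith⟩
  have hℓs : (⟨ℓ.a, ℓ.y, ℓ.x⟩ : Letter).OnAlphabet h := by
    obtain ⟨e, n⟩ := hℓ; refine ⟨?_, n⟩; unfold Letter.height at e ⊢; simp only at e ⊢; linarith
  have hℓs' : (⟨ℓ'.a, ℓ'.y, ℓ'.x⟩ : Letter).OnAlphabet h := by
    obtain ⟨e, n⟩ := hℓ'; refine ⟨?_, n⟩; unfold Letter.height at e ⊢; simp only at e ⊢; linarith
  exact cross_coord_le_two_x hh hℓs hℓs' hsw (by simpa using hy)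

end QS

open QS (quadrant_slide delta_eq abs_sub_abs_of_mul_neg nullStep_pyth cross_coord_le_two_x cross_coord_le_two_y)

/-! ## §5 The supplier geometry of the ray components (null steps; `ℓ` below `ℓ'`) -/

theorem max_le_max_of_abs {a b : ℤ} (hab : 0 ≤ a * b) (h : |b| ≤ |a|) : max 0 b ≤ max 0 a := by
  rcases le_or_gt b 0 with hb | hb
  · rw [max_eq_left hb]; exact le_max_left _ _
  · have ha : 0 < a := by
      by_contra ha'
      push Not at ha'
      rcases eq_or_lt_of_le ha' with h0 | hneg
      · rw [h0, abs_zero] at h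
        have : b = 0 := abs_eq_zero.mp (le_antisymm h (abs_nonneg b))
        rw [this] at hb; exact lt_irrefl _ hb
      · nlinarith
    rw [max_eq_right hb.le, max_eq_right ha.le]
    rw [abs_of_pos hb, abs_of_pos ha] at h
    exact h

/-- **RAY COMPONENTS GROW DOWN A QUADRANT-KEEPING NULL STEP**: if `ℓ` is a null step below `ℓ'` and no coordinate changes strict
sign, then `λ(ℓ',p) ≤ λ(ℓ,p)` for every ray `p` (the step is axis-parallel outward, `QuadrantSlide.quadrant_slide`). -/
theorem lam_mono_of_nullStep {h : ℤ} {ℓ ℓ' : Letter} (hℓ : ℓ.OnAlphabet h) (hℓ' : ℓ'.OnAlphabet h)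
    (hx : 0 ≤ ℓ.x * ℓ'.x) (hy : 0 ≤ ℓ.y * ℓ'.y) (hs : NullStep ℓ ℓ') (p : ZMod 4) : lam ℓ' p ≤ lam ℓ p := by
  have key : ∀ {a b : ℤ}, 0 ≤ a * b → |b| ≤ |a| → max 0 b ≤ max 0 a ∧ max 0 (-b) ≤ max 0 (-a) := fun hab hle =>
    ⟨max_le_max_of_abs hab hle, max_le_max_of_abs (by rwa [neg_mul_neg]) (by rwa [abs_neg, abs_neg])⟩
  rcases quadrant_slide hℓ hℓ' hx hy hs with ⟨hxe, hylt⟩ | ⟨hye, hxlt⟩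
  · rcases zmod4_cases p with rfl | rfl | rfl | rfl
    · rw [lam_zero, lam_zero, hxe]
    · rw [lam_one, lam_one]; exact (key hy hylt.le).1
    · rw [lam_two, lam_two, hxe]
    · rw [lam_three, lam_three]; exact (key hy hylt.le).2
  · rcases zmod4_cases p with rfl | rfl | rfl | rfl
    · rw [lam_zero, lam_zero]; exact (key hx hxlt.le).1
    · rw [lam_one, lam_one, hye]
    · rw [lam_two, lam_two]; exact (key hx hxlt.le).2
    · rw [lam_three, lam_three, hye]

/-- hence the class weight grows along a SUPPLIER PAIR whose two block steps keep their quadrants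
(`x` supplies `y`: equal off the block, equal or a null step below on the block). -/
theorem wray_mono_of_supplies {h : ℤ} {x y : Cell} (hx : ∀ f, (x f).OnAlphabet h) (hy : ∀ f, (y f).OnAlphabet h)
    {g j : Fin 4} (hS : Supplies x y g j)
    (hq : ∀ f, 0 ≤ (x f).x * (y f).x ∧ 0 ≤ (x f).y * (y f).y) (τ : PT) : wray τ y ≤ wray τ x := by
  obtain ⟨hoff, hg, hj⟩ := hS
  unfold wray
  refine Finset.prod_le_prod (fun f _ => lam_nonneg _ _) fun f _ => ?_
  have step : ∀ f', (x f' = y f' ∨ NullStep (x f') (y f')) → lam (y f') (τ f') ≤ lam (x f') (τ f') := fun f' hf' => by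
    rcases hf' with he | hn
    · rw [he]
    · exact lam_mono_of_nullStep (hx f') (hy f') (hq f').1 (hq f').2 hn (τ f')
  by_cases hfg : f = g
  · subst hfg; exact step f hg
  by_cases hfj : f = j
  · subst hfj; exact step f hj
  · rw [hoff f hfg hfj]

/-- in a CROSSING null step the other coordinate grows: `x·x' < 0 ⟹ |y'| ≤ |y|` (indeed by `≥ 2|x'|`). -/
theorem abs_y_le_of_cross_x {h : ℤ} {ℓ ℓ' : Letter} (hℓ : ℓ.OnAlphabet h) (hℓ' : ℓ'.OnAlphabet h) (hs : NullStep ℓ ℓ')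
    (hx : ℓ.x * ℓ'.x < 0) : |ℓ'.y| + 2 * |ℓ'.x| ≤ |ℓ.y| := by
  have hΔ := delta_eq hℓ hℓ'
  have h1 := abs_sub_abs_of_mul_neg hx
  have hpy := nullStep_pyth hs
  have hΔ0 : 0 < ℓ'.a - ℓ.a := by linarith [hs.1]
  have hpx : |ℓ.x - ℓ'.x| ≤ ℓ'.a - ℓ.a :=
    abs_le_of_sq_le_sq (by nlinarith [sq_nonneg (ℓ.y - ℓ'.y)]) hΔ0.le
  linarith

/-- the `y`-crossing version: `y·y' < 0 ⟹ |x'| + 2|y'| ≤ |x|`. -/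
theorem abs_x_le_of_cross_y {h : ℤ} {ℓ ℓ' : Letter} (hℓ : ℓ.OnAlphabet h) (hℓ' : ℓ'.OnAlphabet h) (hs : NullStep ℓ ℓ')
    (hy : ℓ.y * ℓ'.y < 0) : |ℓ'.x| + 2 * |ℓ'.y| ≤ |ℓ.x| := by
  have hΔ := delta_eq hℓ hℓ'
  have h1 := abs_sub_abs_of_mul_neg hy
  have hpy := nullStep_pyth hs
  have hΔ0 : 0 < ℓ'.a - ℓ.a := by linarith [hs.1]
  have hpx : |ℓ.y - ℓ'.y| ≤ ℓ'.a - ℓ.a :=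
    abs_le_of_sq_le_sq (by nlinarith [sq_nonneg (ℓ.x - ℓ'.x)]) hΔ0.le
  linarith

/-- **ALONG ANY NULL STEP A RAY COMPONENT EITHER GROWS OR WAS SMALL** (`h ≤ 14`): `λ(ℓ',p) ≤ λ(ℓ,p)` or `λ(ℓ',p) ≤ 2`.
So the threshold regions `{w_τ ≥ s}` of the supplier calculus are closed under every supplier step except the Pythagorean
steps out of letters with a coordinate `±1, ±2` (`QuadrantSlide` §2). -/
theorem lam_mono_or_le_two {h : ℤ} (hh : h ≤ 14) {ℓ ℓ' : Letter} (hℓ : ℓ.OnAlphabet h) (hℓ' : ℓ'.OnAlphabet h)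
    (hs : NullStep ℓ ℓ') (p : ZMod 4) : lam ℓ' p ≤ lam ℓ p ∨ lam ℓ' p ≤ 2 := by
  rcases le_or_gt 0 (ℓ.x * ℓ'.x) with hx | hx <;> rcases le_or_gt 0 (ℓ.y * ℓ'.y) with hy | hy
  · exact Or.inl (lam_mono_of_nullStep hℓ hℓ' hx hy hs p)
  · -- `y` crosses, `x` keeps its sign and grows
    have h2 := cross_coord_le_two_y hh hℓ hℓ' hs hy
    have hgx := abs_x_le_of_cross_y hℓ hℓ' hs hy
    have hxle : |ℓ'.x| ≤ |ℓ.x| := by linarith [abs_nonneg ℓ'.y]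
    rcases zmod4_cases p with rfl | rfl | rfl | rfl
    · left; rw [lam_zero, lam_zero]; exact max_le_max_of_abs hx hxle
    · right; rw [lam_one]; exact max_le (by norm_num) ((le_abs_self _).trans h2)
    · left; rw [lam_two, lam_two]
      exact max_le_max_of_abs (by rwa [neg_mul_neg]) (by rwa [abs_neg, abs_neg])
    · right; rw [lam_three]; exact max_le (by norm_num) ((neg_le_abs _).trans h2)
  · -- `x` crosses, `y` keeps its sign and grows
    have h2 := cross_coord_le_two_x hh hℓ hℓ' hs hx
    have hgy := abs_y_le_of_cross_x hℓ hℓ' hs hx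
    have hyle : |ℓ'.y| ≤ |ℓ.y| := by linarith [abs_nonneg ℓ'.x]
    rcases zmod4_cases p with rfl | rfl | rfl | rfl
    · right; rw [lam_zero]; exact max_le (by norm_num) ((le_abs_self _).trans h2)
    · left; rw [lam_one, lam_one]; exact max_le_max_of_abs hy hyle
    · right; rw [lam_two]; exact max_le (by norm_num) ((neg_le_abs _).trans h2)
    · left; rw [lam_three, lam_three]
      exact max_le_max_of_abs (by rwa [neg_mul_neg]) (by rwa [abs_neg, abs_neg])
  · -- both cross: all four components of the upper letter are `≤ 2`
    have h2x := cross_coord_le_two_x hh hℓ hℓ' hs hx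
    have h2y := cross_coord_le_two_y hh hℓ hℓ' hs hy
    right
    rcases zmod4_cases p with rfl | rfl | rfl | rfl
    · rw [lam_zero]; exact max_le (by norm_num) ((le_abs_self _).trans h2x)
    · rw [lam_one]; exact max_le (by norm_num) ((le_abs_self _).trans h2y)
    · rw [lam_two]; exact max_le (by norm_num) ((neg_le_abs _).trans h2x)
    · rw [lam_three]; exact max_le (by norm_num) ((neg_le_abs _).trans h2y)

/-- the located obstruction, positively: if the upper letter's component along `p` is `≥ 3`, every null step below it keeps
(indeed weakly increases) that component — the DEEP parts of the threshold regions are supplier-closed (`h ≤ 14`). -/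
theorem lam_mono_of_three_le {h : ℤ} (hh : h ≤ 14) {ℓ ℓ' : Letter} (hℓ : ℓ.OnAlphabet h) (hℓ' : ℓ'.OnAlphabet h)
    (hs : NullStep ℓ ℓ') {p : ZMod 4} (h3 : 3 ≤ lam ℓ' p) : lam ℓ' p ≤ lam ℓ p := by
  rcases lam_mono_or_le_two hh hℓ hℓ' hs p with hle | hle
  · exact hle
  · exfalso; linarith

end Summit.HodgeConjecture.HodgeConjecture.Cruxes.BlochSeedDiscOne.RayClassMeasure
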